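import Literature.NumberTheory.Automorphic.ArchimedeanLieDerivSpans
import HarnessLib

/-!
# Stability of the space of automorphic forms (Borel–Jacquet 4.3) for a general regular datum:
the group part and the `𝔨`-part proved, the `𝔤`-part on its analytic inputs

Topic `NumberTheory/Automorphic`; sibling proof file of `AutomorphicForms`, working towards its named
fact `automorphicForms_isStableSubmodule 𝒟` (Borel–Jacquet 1979, 4.3: for a regular automorphy
datum `𝒟` over a finite-dimensional coefficient algebra, the space `𝒜 = automorphicForms 𝒟` is a
`(𝔤, K_∞) × G(𝔸_f)`-stable subspace, `IsStableSubmodule 𝒟 𝒜`; "these actions define a structure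
of `(𝔤, K_∞) × G(𝔸_f)`-module"). Printed proof (Borel–Jacquet 1979, 4.3; Borel 1997, 2.14, 2.16 and
5.6; Moeglin–Waldspurger I.2.17): stability under `G(𝔸_f)` and `K_∞` is elementary (properties of
the height, §4.2 and §1.2; conjugation of levels); stability under `X ∈ 𝔤` needs, besides the
calculus of §1.5 (`X φ` smooth; `K_∞`-finite by 2.16; `Z(𝔤)`-finite since `Z(𝔤)` is central), the
moderate growth of `X φ`, which rests on Harish-Chandra's convolution identity `φ = φ ∗ α`,
`α ∈ C_c^∞(G_∞)` (Harish-Chandra 1966, Thm. 1; Borel 1997, Thm. 2.14 and 5.6) — a deep analytic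
theorem (analyticity/elliptic regularity of `Z(𝔤)`-finite `K`-finite functions) that the tree has
only as a named fact and only for `GL_n` (`AutomorphicRepsGL.exists_convolution_eq_self`,
`HarishChandraConvolutionGL`). This file PROVES, for a general regular datum:

* `AutomorphyDatum.IsRegular.exists_level_conj` — levels refine under `G(𝔸_f)`-conjugation
  (conjugation is a homeomorphism of `G(𝔸_f)`, levels are open and cofinal);
  `AutomorphyDatum.IsRegular.automorphicForms_le_comap_rightTranslation` — **`𝒜` is
  `G(𝔸_f)`-stable** (the field `IsStableSubmodule.finite_stable`), and
  `AutomorphyDatum.IsRegular.automorphicForms_le_comap_rightTranslation_ofK` — **`𝒜` is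
  `K_∞`-stable** (the field `k_stable`), from `AutomorphicFormsTranslates`,
  `AutomorphicFormsKTranslates` and the height axioms of `IsRegular`;
* `automorphicForms_lieDeriv_mem_of_mem_compactLie` — **the `𝔨`-part of the `𝔤`-stability,
  unconditionally**: for `Y ∈ 𝔨 = 𝔤 ∩ 𝔲(N, A)`, `Y` maps `𝒜` into `𝒜` (the `K_∞`-span of an
  automorphic form consists of automorphic forms and is `𝔨`-stable,
  `IsArchSmooth.lieDeriv_mem_kTranslateSpan` of `ArchimedeanLieDerivSpans`);
* the full `𝔤`-part on its inputs: `IsAutomorphicForm.lieDeriv_of_hasModerateGrowth` (`X φ` is an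
  automorphic form as soon as it has moderate growth, granted the calculus facts
  `isArchSmooth_lieDeriv`, `applyFree_congr` of `ArchimedeanCalculus` for `ι = 𝒟.ofArch`),
  `automorphicForms_lieDeriv_mem_of`, and the assembly **`automorphicForms_isStableSubmodule_of`**:
  `isArchSmooth_lieDeriv → applyFree_congr → (moderate growth of every X φ) →
  automorphicForms_isStableSubmodule 𝒟`.

What is NOT here (the residual trust base of the named fact): the two calculus facts for a general
regular `H` (for `𝔤 = 𝔤𝔩(N, A)` they are `isArchSmooth_lieDeriv_holds_of_lie_eq_top`,
`applyFree_congr_of_top`; in general they need the closed-subgroup theorem: `exp|_𝔤` is a local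
homeomorphism onto a neighbourhood of `1` in `H`), and the moderate growth of `X φ` for `X ∈ 𝔭`
(Harish-Chandra's convolution identity on a general real reductive group). Everything here is
proved; no definitions, no named facts.

## References

* A. Borel, H. Jacquet, *Automorphic forms and automorphic representations*, Proc. Sympos. Pure
  Math. 33 (Corvallis 1977), Part 1 (1979), 189–202, §4.1–4.3 [BorelJacquetCorvallis1979].
* A. Borel, *Automorphic forms on `SL₂(ℝ)`*, Cambridge Tracts in Math. 130 (1997), 2.14, 2.16,
  5.6 [Borel1997].
* J. R. Getz, H. Hahn, *An Introduction to Automorphic Representations*, GTM 300 (2024), §6.3,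
  Def. 6.5 and (6.7), p. 118 [GetzHahn2024].
-/

noncomputable section

open scoped MatrixGroups Matrix ContDiff Topology

namespace Literature.NumberTheory.Automorphic

/-! ### The automorphy datum: `G(𝔸_f)`- and `K_∞`-stability of `𝒜`, the `𝔨`-part, the assembly -/

section Datum

variable {K : Type} [Field K] [NumberField K]
  {A : Type*} [NormedCommRing A] [NormedAlgebra ℝ A] [NormedAlgebra ℚ A] [CompleteSpace A]
  [StarRing A] {N : Type*} [Fintype N] [DecidableEq N]
  {𝒢 : AdelicGroupData K} {𝒟 : AutomorphyDatum 𝒢 A N}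

/-- **Levels refine under finite-adelic conjugation** for a regular datum: for `h ∈ G(𝔸_f)` and a
level `U`, the conjugate `h U h⁻¹` meets `G(𝔸_f)` in an open subgroup (conjugation by `h` is a
homeomorphism of the topological group `G(𝔸_f)`, and levels are open, `IsRegular.isOpen_level`), so
it contains a level `U'` (`IsRegular.exists_level_le`): `h⁻¹ u h ∈ U` for `u ∈ U'`.
Borel–Jacquet 1979, §4.1 (compact open subgroups of `G(𝔸_f)` form a fundamental system of
neighbourhoods of `1`) and 4.3. [cite: BorelJacquetCorvallis1979, §4.1 and 4.3] -/
theorem AutomorphyDatum.IsRegular.exists_level_conj (h𝒟 : 𝒟.IsRegular) {h : 𝒢.Adelic}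
    (hh : h ∈ 𝒟.finiteAdelic) {U : Subgroup 𝒢.Adelic} (hU : U ∈ 𝒟.finiteLevels) :
    ∃ U' ∈ 𝒟.finiteLevels, ∀ u ∈ U', h⁻¹ * u * h ∈ U := by
  -- the conjugate level `h U h⁻¹`, as the preimage of `U` under conjugation by `h⁻¹`
  set V : Subgroup 𝒢.Adelic := U.comap (MulAut.conj h⁻¹).toMonoidHom with hV
  have hVmem : ∀ x, x ∈ V ↔ h⁻¹ * x * h ∈ U := fun x => by
    simp [hV]
  -- conjugation by `h` restricted to `G(𝔸_f)` is continuous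
  set c : 𝒟.finiteAdelic → 𝒟.finiteAdelic := fun x =>
    ⟨h⁻¹ * x * h, mul_mem (mul_mem (inv_mem hh) x.2) hh⟩ with hc_def
  have hc : Continuous c :=
    ((continuous_const.mul continuous_subtype_val).mul continuous_const).subtype_mk _
  have hVeq : ((V.comap 𝒟.finiteAdelic.subtype : Subgroup 𝒟.finiteAdelic) : Set 𝒟.finiteAdelic) =
      c ⁻¹' ((U.comap 𝒟.finiteAdelic.subtype : Subgroup 𝒟.finiteAdelic) : Set 𝒟.finiteAdelic) := by
    ext x
    simp [Subgroup.mem_subgroupOf, hVmem, hc_def]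
  have hVopen : IsOpen ((V.comap 𝒟.finiteAdelic.subtype : Subgroup 𝒟.finiteAdelic) :
      Set 𝒟.finiteAdelic) := by
    rw [hVeq]
    exact (h𝒟.isOpen_level U hU).preimage hc
  obtain ⟨U', hU', hle⟩ := h𝒟.exists_level_le V hVopen
  exact ⟨U', hU', fun u hu => (hVmem u).1 (hle hu)⟩

/-- **`𝒜` is stable under right translation by `G(𝔸_f)`** for a regular datum (Borel–Jacquet 1979,
4.3: "`𝒜` is stable under `G(𝔸_f)`", the field `IsStableSubmodule.finite_stable`): `h ∈ G(𝔸_f)`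
centralises `G_∞` (`commute_ofArch`), levels refine under `h`-conjugation (`exists_level_conj`) and
`1 ⊔ ‖g h‖ ≤ C_h (1 ⊔ ‖g‖)` (`IsRegular.height_mul_le`), so
`automorphicForms_le_comap_rightTranslation` applies. [cite: BorelJacquetCorvallis1979, 4.3] -/
theorem AutomorphyDatum.IsRegular.automorphicForms_le_comap_rightTranslation (h𝒟 : 𝒟.IsRegular)
    {h : 𝒢.Adelic} (hh : h ∈ 𝒟.finiteAdelic) :
    automorphicForms 𝒟 ≤ (automorphicForms 𝒟).comap (rightTranslation 𝒢 h) := by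
  obtain ⟨C, hC⟩ := h𝒟.height_mul_le h hh
  exact _root_.Literature.NumberTheory.Automorphic.automorphicForms_le_comap_rightTranslation
    (fun x => 𝒟.commute_ofArch x h hh) (fun U hU => h𝒟.exists_level_conj hh hU) hC

/-- **The `K_∞`-translates of an automorphic form span a subspace of `𝒜`** for a regular datum over
a finite-dimensional coefficient algebra: each `r(k) φ` is an automorphic form
(`IsAutomorphicForm.rightTranslation_ofK`, the height bound being `IsRegular.height_mul_ofArch_le` on
the compact set `{k}`). Borel–Jacquet 1979, 4.3 (`𝒜` is stable under `K_∞`). [cite: BorelJacquetCorvallis1979, 4.3] -/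
theorem IsAutomorphicForm.kTranslateSpan_le_automorphicForms [FiniteDimensional ℝ A]
    (h𝒟 : 𝒟.IsRegular) {φ : 𝒢.Adelic → ℂ} (hφ : IsAutomorphicForm 𝒟 φ) :
    kTranslateSpan 𝒟.ofArch φ ≤ automorphicForms 𝒟 := by
  refine Submodule.span_le.2 ?_
  rintro _ ⟨k, rfl⟩
  obtain ⟨C, hC⟩ := h𝒟.height_mul_ofArch_le
    {Subgroup.inclusion 𝒟.arch.maximalCompact_le_carrier k} isCompact_singleton
  exact (hφ.rightTranslation_ofK k (hC _ (Set.mem_singleton _))).mem_automorphicForms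

/-- **`𝒜` is stable under right translation by `K_∞`** for a regular datum over a
finite-dimensional coefficient algebra (Borel–Jacquet 1979, 4.3; the field
`IsStableSubmodule.k_stable`). [cite: BorelJacquetCorvallis1979, 4.3] -/
theorem AutomorphyDatum.IsRegular.automorphicForms_le_comap_rightTranslation_ofK
    [FiniteDimensional ℝ A] (h𝒟 : 𝒟.IsRegular) (k : 𝒟.arch.maximalCompact) :
    automorphicForms 𝒟 ≤ (automorphicForms 𝒟).comap (rightTranslation 𝒢 (𝒟.ofK k)) := by
  refine Submodule.span_le.2 fun φ hφ => ?_
  rw [SetLike.mem_coe, Submodule.mem_comap, ← 𝒟.archTranslate_ofK]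
  exact (IsAutomorphicForm.kTranslateSpan_le_automorphicForms h𝒟 hφ)
    (archTranslate_mem_kTranslateSpan 𝒟.ofArch k φ)

/-- **The `𝔨`-part of the `𝔤`-stability of `𝒜`, unconditionally**: for a regular datum over a
finite-dimensional coefficient algebra and `Y ∈ 𝔨 = 𝔤 ∩ 𝔲(N, A)` (so `exp(tY) ∈ K_∞`), the Lie
derivative `Y φ` of every `φ ∈ 𝒜` lies in `𝒜`: for an automorphic form `φ`, `Y φ` lies in the
span of its `K_∞`-translates (`IsArchSmooth.lieDeriv_mem_kTranslateSpan`), which are automorphic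
forms; the span case follows by additivity of `Y` on smooth functions. Borel–Jacquet 1979, 4.3
(`𝒜` is a `(𝔤, K_∞)`-module; here the directions in `𝔨`, which need no convolution identity);
Borel 1997, 2.16. [cite: BorelJacquetCorvallis1979, 4.3] -/
theorem automorphicForms_lieDeriv_mem_of_mem_compactLie [FiniteDimensional ℝ A] [StarModule ℝ A]
    [ContinuousStar A] (h𝒟 : 𝒟.IsRegular) {Y : 𝒟.arch.lie}
    (hY : (Y : Matrix N N A) ∈ 𝒟.arch.compactLie) {φ : 𝒢.Adelic → ℂ}
    (hφ : φ ∈ automorphicForms 𝒟) : lieDeriv 𝒟.ofArch Y φ ∈ automorphicForms 𝒟 := by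
  -- Mathlib idiom (Mathlib/Algebra/Lie/OfAssociative.lean), needed to use `𝔨 = compactLie`
  letI : LieRing (Matrix N N A) := LieRing.ofAssociativeRing
  have hYt : ∀ t : ℝ, (𝒟.arch.expMem (t • Y) : GL N A) ∈ 𝒟.arch.maximalCompact := fun t =>
    (𝒟.arch.expK ⟨t • (Y : Matrix N N A), 𝒟.arch.compactLie.smul_mem t hY⟩).2
  induction hφ using Submodule.span_induction with
  | mem ψ hψ =>
    exact hψ.kTranslateSpan_le_automorphicForms h𝒟
      (hψ.archSmooth.lieDeriv_mem_kTranslateSpan hψ.kFinite hYt)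
  | zero => rw [lieDeriv_zero_right]; exact zero_mem _
  | add ψ₁ ψ₂ hψ₁ hψ₂ ih₁ ih₂ =>
    rw [IsArchSmooth.lieDeriv_add _ Y (automorphicForms_le_archSmooth 𝒟 hψ₁)
      (automorphicForms_le_archSmooth 𝒟 hψ₂)]
    exact add_mem ih₁ ih₂
  | smul c ψ _ ih => rw [lieDeriv_smul]; exact Submodule.smul_mem _ c ih

/-- **`X φ` is an automorphic form as soon as it has moderate growth** (Borel–Jacquet 1979, 4.3, the
`𝔤`-stability of `𝒜`, with its analytic inputs displayed): for a datum over a finite-dimensional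
coefficient algebra, granted the calculus facts `isArchSmooth_lieDeriv` and `applyFree_congr` of
`ArchimedeanCalculus` for `ι = 𝒟.ofArch`, if `φ` is an automorphic form and `X φ` has moderate
growth then `X φ` is an automorphic form: left `G(K)`-invariance is inherited pointwise, the level
is kept (it centralises `G_∞`, `lieDeriv_comp_mul_right`), `X φ` is smooth (first fact),
`K_∞`-finite (`isKFinite_lieDeriv`; Borel 1997, 2.16) and `Z(𝔤)`-finite (`isZFinite_lieDeriv_of`).
[cite: BorelJacquetCorvallis1979, 4.3] -/
theorem IsAutomorphicForm.lieDeriv_of_hasModerateGrowth [FiniteDimensional ℝ A]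
    (hs : isArchSmooth_lieDeriv (ι := 𝒟.ofArch)) (hc : applyFree_congr (ι := 𝒟.ofArch))
    {φ : 𝒢.Adelic → ℂ} (hφ : IsAutomorphicForm 𝒟 φ) (X : 𝒟.arch.lie)
    (hX : HasModerateGrowth 𝒟 (lieDeriv 𝒟.ofArch X φ)) :
    IsAutomorphicForm 𝒟 (lieDeriv 𝒟.ofArch X φ) where
  leftInvariant γ hγ g := by
    have hleft : ∀ g', φ (γ * g') = φ g' := hφ.leftInvariant γ hγ
    simp only [lieDeriv, mul_assoc, hleft]
  exists_level := by
    obtain ⟨U, hU, hφU⟩ := hφ.exists_level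
    refine ⟨U, hU, fun u hu g => ?_⟩
    have hcomm : ∀ x : 𝒟.arch.carrier, 𝒟.ofArch x * u = u * 𝒟.ofArch x :=
      fun x => 𝒟.commute_ofArch x u (𝒟.le_finiteAdelic U hU hu)
    have hfix : (fun g' => φ (g' * u)) = φ := funext fun g' => hφU u hu g'
    have key := lieDeriv_comp_mul_right 𝒟.ofArch X φ hcomm
    rw [hfix] at key
    exact (congrFun key g).symm
  archSmooth := hs X hφ.archSmooth
  kFinite :=
    isKFinite_lieDeriv _ (fun k => isArchSmooth_archTranslate _ _ hφ.archSmooth) hφ.kFinite X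
  zFinite := isZFinite_lieDeriv_of hs hc hφ.archSmooth hφ.zFinite X
  moderateGrowth := hX

/-- **The `𝔤`-stability of `𝒜` on its analytic inputs**: granted the two calculus facts and the
moderate growth of `X φ` for every automorphic form `φ` and `X ∈ 𝔤` (in print: Harish-Chandra's
convolution identity `φ = φ ∗ α`, whence `X φ = φ ∗ α'`; Borel–Jacquet 1979, 4.3; Borel 1997, 2.14
and 5.6), `X` maps `𝒜` into itself (span induction, `X` being additive on smooth functions).
[cite: BorelJacquetCorvallis1979, 4.3] -/
theorem automorphicForms_lieDeriv_mem_of [FiniteDimensional ℝ A]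
    (hs : isArchSmooth_lieDeriv (ι := 𝒟.ofArch)) (hc : applyFree_congr (ι := 𝒟.ofArch))
    (hg : ∀ φ : 𝒢.Adelic → ℂ, IsAutomorphicForm 𝒟 φ →
      ∀ X : 𝒟.arch.lie, HasModerateGrowth 𝒟 (lieDeriv 𝒟.ofArch X φ))
    (X : 𝒟.arch.lie) {φ : 𝒢.Adelic → ℂ} (hφ : φ ∈ automorphicForms 𝒟) :
    lieDeriv 𝒟.ofArch X φ ∈ automorphicForms 𝒟 := by
  induction hφ using Submodule.span_induction with
  | mem ψ hψ => exact (hψ.lieDeriv_of_hasModerateGrowth hs hc X (hg ψ hψ X)).mem_automorphicForms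
  | zero => rw [lieDeriv_zero_right]; exact zero_mem _
  | add ψ₁ ψ₂ hψ₁ hψ₂ ih₁ ih₂ =>
    rw [IsArchSmooth.lieDeriv_add _ X (automorphicForms_le_archSmooth 𝒟 hψ₁)
      (automorphicForms_le_archSmooth 𝒟 hψ₂)]
    exact add_mem ih₁ ih₂
  | smul c ψ _ ih => rw [lieDeriv_smul]; exact Submodule.smul_mem _ c ih

/-- **Borel–Jacquet 4.3 on its analytic inputs** (reduction of the named fact
`automorphicForms_isStableSubmodule 𝒟` of `AutomorphicForms`): for an automorphy datum `𝒟`, granted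
(1) `isArchSmooth_lieDeriv` and (2) `applyFree_congr` for `ι = 𝒟.ofArch` (Borel–Jacquet §1.5; in
the tree for `𝔤 = 𝔤𝔩(N, A)`, `ArchimedeanLieDerivSmooth`, `ArchimedeanEnvelopingAction`) and (3) the
moderate growth of the Lie derivatives `X φ` of automorphic forms of a regular `𝒟`
(Harish-Chandra's convolution identity; Borel 1997, 2.14, 5.6), the space of automorphic forms of a
regular `𝒟` over a finite-dimensional coefficient algebra is `(𝔤, K_∞) × G(𝔸_f)`-stable: the group
part is `IsRegular.automorphicForms_le_comap_rightTranslation{,_ofK}` (proved outright), the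
`𝔤`-part is `automorphicForms_lieDeriv_mem_of`. [cite: BorelJacquetCorvallis1979, 4.3] -/
theorem automorphicForms_isStableSubmodule_of
    (hs : isArchSmooth_lieDeriv (ι := 𝒟.ofArch)) (hc : applyFree_congr (ι := 𝒟.ofArch))
    (hg : ∀ [FiniteDimensional ℝ A], 𝒟.IsRegular → ∀ φ : 𝒢.Adelic → ℂ, IsAutomorphicForm 𝒟 φ →
      ∀ X : 𝒟.arch.lie, HasModerateGrowth 𝒟 (lieDeriv 𝒟.ofArch X φ)) :
    automorphicForms_isStableSubmodule 𝒟 := by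
  intro _ h𝒟
  exact
    { le_automorphicForms := le_rfl
      finite_stable := fun h hh => h𝒟.automorphicForms_le_comap_rightTranslation hh
      k_stable := fun k => h𝒟.automorphicForms_le_comap_rightTranslation_ofK k
      lie_stable := fun X φ hφ => automorphicForms_lieDeriv_mem_of hs hc (hg h𝒟) X hφ }

end Datum

end Literature.NumberTheory.Automorphic
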